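import Literature.Barriers.FinalStateConjecture.TrappingDerivativeLoss
import HarnessLib

/-!
# Sbierski's Kerr trapping theorem: the LED criterion proved, the Gaussian-beam input vendored
(companion "Proofs" file of `Literature/Barriers/FinalStateConjecture/TrappingDerivativeLoss.lean`;
family `gr`, summit `FinalStateConjecture`; namespace `Literature.Barriers.FinalStateConjecture`)

That file vendors, as named facts, Sbierski's theorem that on the Kerr exterior `0 ≤ a ≤ M`,
`M > 0`, no local-energy-decay estimate `E^N_τ[u](Σ_τ ∩ 𝒯) ≤ P(τ) E^N_0[u]` with `P(τ) → 0` can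
hold uniformly over the solutions of `□_g u = 0` (`SbierskiKerrTrappingLED`, the print-literal
form of Anal. PDE 8 (2015), Thm. 7.4; `SbierskiTrappingObstruction`, its data-localised reading).
The printed proof has two layers:

1. **(hard, PDE)** Thm. 7.4 "invokes Theorem 5.5", whose proof obtains its contradiction from the
   *localised solutions* of Thm. 5.1: for a null geodesic `γ` with `γ(0) ∈ Σ₀`, any neighbourhood
   `𝒩` of `γ`, any `T > 0` and `μ > 0`, "there exists a solution `v ∈ C^∞(M, ℂ)` of the wave
   equation with `E^N_0(v) = −g(N, γ̇)|_{γ(0)}` such that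
   `|E^N_{τ, 𝒩 ∩ Σ_τ}(v) − [−g(N, γ̇)|_{Im γ ∩ Σ_τ}]| < μ` for all `0 ≤ τ ≤ T`" (real-valued `v`
   allowed, remark after Thm. 5.1; the Cauchy data of `v` on `Σ₀` are those of the Gaussian beam,
   supported in `𝒩`, proof of Thm. 2.1), applied in the domain of outer communications of Kerr to
   a *trapped* null geodesic `γ_{r₀}`, `r₀ ∈ [r_δ, r_ρ]`, whose `N`-energy `−g(N, γ̇)` "is
   bounded away from zero and infinity" (§7A). This layer rests on the well-posed Cauchy problem
   and the energy estimate for `□_g` on the globally hyperbolic `D(Σ₀)` (proof of Thm. 2.1), on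
   the Gaussian-beam construction and on the characterisation of the energy of Gaussian beams
   (§3–§4; arXiv §2.2–2.3) — none of which is in Mathlib or in `Literature/`, where the Kerr
   wave operator has its coordinate and divergence forms (`Kerr.dalembertian_eq_sum`,
   `Kerr.dalembertian_eq_divergence`, `KerrSchildCoord.lean`) and energy identities
   (`KerrEnergyIdentity.lean`), but no solvability of the Cauchy problem: the only solutions of
   `□_g ψ = 0` in the tree are the constants (`dalembertian_const`). It is vendored here, in the
   rendering of the parent file (coordinate energies `sliceEnergy`/`localSliceEnergy` on the
   Kerr–Schild leaves, region `𝒯 = {‖y‖ < R}`, `R ≥ R₀(M, a)`, solutions `C^∞` on the chart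
   `Kerr.exterior M a` solving `□_g ψ = 0` on `{t* > 0}`, data supported in `{‖y‖ ≤ R}`), as the
   named fact `SbierskiKerrLocalisedSolutions` (D-0014: a `def … : Prop`, nothing asserted).
2. **(soft)** the proof of Thm. 5.5: "Assume the contrary […]. There is then a `0 ≤ τ₀ < τ*` with
   `−g(N, γ̇)|_{Im γ ∩ Σ_{τ₀}} > −g(N, γ̇)|_{Im γ ∩ Σ₀} C₀ P(τ₀)`. Choosing now `μ > 0` small enough
   and a neighbourhood `𝒩 ⊆ 𝒯` of `γ` small enough […] we obtain a contradiction." This layer is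
   **proved** here: `SbierskiTrappingObstruction.of_localisedSolutions` and
   `SbierskiKerrTrappingLED.of_localisedSolutions` (via the parent file's
   `SbierskiTrappingObstruction.literal`); and, by the same argument in the integrated form of
   the ILED criterion Thm. 5.7 (arXiv Thm. 10), the non-degenerate integrated estimate
   `∫₀^∞ E_loc dτ ≤ C' E₀` is excluded in the same class:
   `SbierskiKerrLocalisedSolutions.not_integratedDecay` (barrier audit 2026-08-15; this closes
   the "ILED criterion not vendored" half of `scope_caveats` (i) of `SbierskiTrappingObstruction`).

Status (provefact triage of `SbierskiKerrTrappingLED`): size XL; `SbierskiKerrTrappingLED_holds`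
is **not** landed — it is `SbierskiKerrTrappingLED.of_localisedSolutions h` once
`h : SbierskiKerrLocalisedSolutions` is discharged, and that discharge needs, bottom-up: (i) global
solvability of the smooth Cauchy problem for `□_g` on `{t* ≥ 0} ⊆ D(Σ₀)` of the Kerr exterior
with the energy estimate of the proof of Thm. 2.1; (ii) Gaussian beams `u_λ = a_𝒩 e^{iλφ}`
along a null geodesic with `‖□u_λ‖_{L²(R_{[0,T]})} ≤ C(T)`, `E^N_0(u_λ) → ∞`, `supp u_λ ⊆ 𝒩`
(the three conditions in the proof of Thm. 2.1) and the energy characterisation of §4 (arXiv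
§2.3); (iii) the trapped null geodesics of Kerr with `N`-energy in `[c_γ, C_γ] ⊂ (0, ∞)` (§7A,
the separated geodesic equations); (iv) the comparability, uniform in `τ`, of the
coordinate energies of `WeightedNorms.lean` with the `J^N`-fluxes through the Kerr–Schild leaves
(parent file, module docstring "Energies").

## Rendering of the vendored input (conventions of the parent file)

For `0 < M`, `0 ≤ a ≤ M` there is `R₀` (the coordinate ball `{‖y‖ ≤ R₀}` carries the photon
region `{r_δ ≤ r ≤ r_ρ}`: `‖y‖² ≤ r² + a²` in Kerr–Schild coordinates) such that for every
`R ≥ R₀` there are reals `0 < c` and `C` — `c = κ c_γ / 2` and `C = K (−g(N, γ̇)|_{γ(0)})` with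
`κ, K` the comparability constants of (iv), so they depend on `(M, a, R)` only — with: for every
`T ≥ 0` some `ψ : Kerr.exterior M a → ℝ`, `C^∞` on the chart, solving `□_{g_{M,a}} ψ = 0` on
`{t* > 0}`, with Cauchy data supported in `{‖y‖ ≤ R}` (`ψ = 0`, `dψ = 0` at the points of
`{t* = 0} ∩ {r > r₊}` with `‖y‖ > R`), has `sliceEnergy ψ 0 ≤ C` and
`localSliceEnergy ψ τ R ≥ c` for all `τ ∈ [0, T]`. This is Thm. 5.1 with `μ = c_γ / 2` and
`𝒩 ⊆ {‖y‖ < R}` a neighbourhood of the trapped `γ = γ_{r₀}` (for which `Σ_T ∩ Im γ ≠ ∅` for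
every `T`, `r` being constant along `γ`), read through (iv); Sbierski's `v` lives on
`D(Σ₀) ⊇ {t* ≥ 0}` and is cut off to a `C^∞` function on the chart agreeing with `v` near
`{t* ≥ 0}` (parent file, "Solutions"). As there, the identification (iv) is argued, not proved.

## References

* J. Sbierski, *Characterisation of the energy of Gaussian beams on Lorentzian manifolds: with
  applications to black hole spacetimes*, Anal. PDE 8 (2015) 1379–1420 (arXiv:1311.2477):
  Thm. 2.1 and its proof (localised solutions: the three conditions on the beam and the energy
  estimate; held arXiv rendering: Thm. 1, §2.1), §3–§4 (construction of Gaussian beams,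
  characterisation of their energy; arXiv §2.2–2.3), Thm. 5.1 (localised solutions with the
  energy of the geodesic; arXiv rendering Thm. 8, §2.4), Thm. 5.5 and its proof (LED criterion;
  arXiv rendering Thm. 9, p. 18), §7A (trapping in (sub)-extremal Kerr: foliation `t*`,
  `N = −(dt*)♯`, trapped null geodesics `γ_{r₀}`, `r₀ ∈ [r_δ, r_ρ]`, with `N`-energy bounded away
  from `0` and `∞`; arXiv rendering §3.2.1, pp. 26–27), Thm. 7.4 (arXiv rendering Thm. 14,
  p. 27). Theorem numbers are those of the journal version, as in the parent file.
-/

noncomputable section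

open Set Filter Topology
open scoped Manifold ContDiff ENNReal

namespace Literature.Barriers.FinalStateConjecture

open Literature.Geometry.Lorentzian

/-- **Sbierski's localised solutions along the trapped null geodesics of Kerr** (named fact; the
PDE input of Thm. 7.4). Sbierski, Anal. PDE 8 (2015), Thm. 5.1: on a time-oriented globally
hyperbolic `(M, g)` with time function `t`, `Σ₀` Cauchy, `γ : [0, S) → M` an affinely
parametrised future-directed null geodesic with `γ(0) ∈ Σ₀`, `N` timelike future directed: "For
any neighbourhood `𝒩` of `γ`, for any `T > 0` with `Σ_T ∩ Im(γ) ≠ ∅`, and for any `μ > 0`, there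
exists a solution `v ∈ C^∞(M, ℂ)` of the wave equation with `E^N_0(v) = −g(N, γ̇)|_{γ(0)}` such
that `|E^N_{τ, 𝒩 ∩ Σ_τ}(v) − [−g(N, γ̇)|_{Im γ ∩ Σ_τ}]| < μ` for all `0 ≤ τ ≤ T`", this estimate
holding "by choosing `𝒩`, if necessary, a bit smaller" without further conditions, `v` real-valued
if desired, its Cauchy data on `Σ₀` those of a Gaussian beam supported in `𝒩` (proof of
Thm. 2.1); and §7A: in the domain of outer communications of Kerr, `0 ≤ a ≤ m`, `m ≠ 0`,
foliated by `t* = v₊ − r` with `N = −(dt*)♯`, "there are trapped null geodesics […] whose energy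
stays bounded away from zero and infinity", namely `γ_{r₀}` on `{r = r₀}`, `r₀ ∈ [r_δ, r_ρ]`.
**Vendored form** (the consequence used in the proof of Thm. 7.4, in the rendering of
`TrappingDerivativeLoss.lean` — coordinate energies on Kerr–Schild leaves, comparability constants
absorbed into `c, C`; module docstring): for `0 < M`, `0 ≤ a ≤ M` there is `R₀` such that for
every `R ≥ R₀` there are `c > 0` and `C` such that for every `T ≥ 0` some
`ψ : Kerr.exterior M a → ℝ`, `C^∞`, solving `□_{g_{M,a}} ψ = 0` on `{t* > 0}`, with Cauchy data
supported in `{‖y‖ ≤ R}`, satisfies `sliceEnergy ψ 0 ≤ C` and `c ≤ localSliceEnergy ψ τ R` for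
all `τ ∈ [0, T]`. Not provable from Mathlib/Literature at present (no existence theory for `□_g`).
[cite: Sbierski2015, Thm. 5.1 and §7A] -/
def SbierskiKerrLocalisedSolutions : Prop :=
  ∀ [Kerr.Facts] [Kerr.SliceFacts] (M a : ℝ), 0 < M → 0 ≤ a → a ≤ M →
    ∃ R₀ : ℝ, ∀ R : ℝ, R₀ ≤ R →
      ∃ c C : ℝ, 0 < c ∧ ∀ T : ℝ, 0 ≤ T →
        ∃ ψ : Kerr.exterior M a → ℝ,
          ContMDiff 𝓘(ℝ, E4) 𝓘(ℝ, ℝ) ∞ ψ ∧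
          (∀ x : Kerr.exterior M a, 0 < (x : E4) 0 →
            (Kerr.smoothMetric M a (Kerr.rPlus M a)).toPseudoRiemannianMetric.dalembertian ψ x
              = 0) ∧
          (∀ x : Kerr.exterior M a, (x : E4) 0 = 0 → R < E4.spatialNorm (x : E4) →
            ψ x = 0 ∧ mfderiv 𝓘(ℝ, E4) 𝓘(ℝ, ℝ) ψ x = 0) ∧
          sliceEnergy (Kerr.exterior M a) ψ 0 ≤ ENNReal.ofReal C ∧
          ∀ τ : ℝ, 0 ≤ τ → τ ≤ T →
            ENNReal.ofReal c ≤ localSliceEnergy (Kerr.exterior M a) ψ τ R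

/-- **The LED criterion, proved** (Sbierski's Thm. 5.5 argument in the vendored rendering): the
localised solutions along trapped null geodesics (`SbierskiKerrLocalisedSolutions`, Thm. 5.1 with
§7A) rule out every uniform rate `P(τ) → 0` for the local energy in the ball in terms of the
first-order initial energy, already within the class of solutions with data supported in the
ball — i.e. they give `SbierskiTrappingObstruction`. Proof as printed (Anal. PDE 8 (2015), proof
of Thm. 5.5): given `R ≥ R₀` and `P > 0` with `P(τ) → 0`, take `c > 0`, `C` from the fact and
`T ≥ 0` with `P(T) · C < c`; the localised solution `ψ` for this `T` has
`localSliceEnergy ψ T R ≥ c > P(T) · C ≥ P(T) · sliceEnergy ψ 0`, contradicting the putative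
estimate at `τ = T`. [cite: Sbierski2015, Thm. 5.5 (proof) and Thm. 7.4] -/
theorem SbierskiTrappingObstruction.of_localisedSolutions (h : SbierskiKerrLocalisedSolutions) :
    SbierskiTrappingObstruction := by
  intro _ _ M a hM ha₀ haM
  obtain ⟨R₀, hR⟩ := h M a hM ha₀ haM
  refine ⟨R₀, fun R hRR P hP hP0 hall ↦ ?_⟩
  obtain ⟨c, C, hc, hsol⟩ := hR R hRR
  -- a time `T ≥ 0` at which the putative rate is already below `c / C`
  have hev : ∀ᶠ τ in atTop, P τ * C < c := by
    have hmul : Tendsto (fun τ ↦ P τ * C) atTop (𝓝 (0 * C)) := hP0.mul_const C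
    rw [zero_mul] at hmul
    exact hmul.eventually (Iio_mem_nhds hc)
  obtain ⟨T, hT₀, hTc⟩ := ((eventually_ge_atTop (0 : ℝ)).and hev).exists
  obtain ⟨ψ, hψ, hwave, hsupp, hE₀, hloc⟩ := hsol T hT₀
  -- the putative estimate at `τ = T` for this localised solution
  have hle : localSliceEnergy (Kerr.exterior M a) ψ T R ≤ ENNReal.ofReal (P T * C) :=
    calc localSliceEnergy (Kerr.exterior M a) ψ T R
        ≤ ENNReal.ofReal (P T) * sliceEnergy (Kerr.exterior M a) ψ 0 :=
          hall ψ hψ hwave hsupp T hT₀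
      _ ≤ ENNReal.ofReal (P T) * ENNReal.ofReal C := by gcongr
      _ = ENNReal.ofReal (P T * C) := (ENNReal.ofReal_mul (hP T).le).symm
  have hlt : ENNReal.ofReal (P T * C) < ENNReal.ofReal c :=
    (ENNReal.ofReal_lt_ofReal_iff hc).2 hTc
  exact absurd ((hloc T hT₀ le_rfl).trans hle) (not_le.2 hlt)

/-- **Sbierski's Kerr trapping theorem from its PDE input**: the localised solutions of Thm. 5.1
along the trapped null geodesics of §7A give the print-literal Thm. 7.4
(`SbierskiKerrTrappingLED`), through the data-localised obstruction and
`SbierskiTrappingObstruction.literal`. This is the whole of the printed proof of Thm. 7.4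
("Invoking Theorem 5.5 we thus obtain") above the named fact `SbierskiKerrLocalisedSolutions`;
`SbierskiKerrTrappingLED_holds` is this theorem applied to a discharge of that fact.
[cite: Sbierski2015, Thm. 7.4 and Thm. 5.5] -/
theorem SbierskiKerrTrappingLED.of_localisedSolutions (h : SbierskiKerrLocalisedSolutions) :
    SbierskiKerrTrappingLED :=
  SbierskiTrappingObstruction.literal (SbierskiTrappingObstruction.of_localisedSolutions h)

/-- Unfolded consequence of the vendored input at fixed admissible `(M, a)`: for `R ≥ R₀` the
class of smooth solutions on `{t* > 0}` with data supported in `{‖y‖ ≤ R}` contains, for every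
`T ≥ 0`, a member whose local energy in the ball at time `T` is at least the fixed fraction
`c / C` of (the bound `C` on) its initial energy — the quantitative content that any admissible
rate `P` must respect (`P(T) ≥ c / C` whenever the estimate holds at `T`). Sbierski, Anal. PDE 8
(2015), Thm. 5.1 with §7A (tautological unfolding at `τ = T`).
[cite: Sbierski2015, Thm. 5.1 and §7A] -/
theorem SbierskiKerrLocalisedSolutions.exists_solution (h : SbierskiKerrLocalisedSolutions)
    [Kerr.Facts] [Kerr.SliceFacts] {M a : ℝ} (hM : 0 < M) (ha₀ : 0 ≤ a) (haM : a ≤ M) :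
    ∃ R₀ : ℝ, ∀ R : ℝ, R₀ ≤ R → ∃ c C : ℝ, 0 < c ∧ ∀ T : ℝ, 0 ≤ T →
      ∃ ψ : Kerr.exterior M a → ℝ, ContMDiff 𝓘(ℝ, E4) 𝓘(ℝ, ℝ) ∞ ψ ∧
        (∀ x : Kerr.exterior M a, 0 < (x : E4) 0 →
          (Kerr.smoothMetric M a (Kerr.rPlus M a)).toPseudoRiemannianMetric.dalembertian ψ x
            = 0) ∧
        (∀ x : Kerr.exterior M a, (x : E4) 0 = 0 → R < E4.spatialNorm (x : E4) →
          ψ x = 0 ∧ mfderiv 𝓘(ℝ, E4) 𝓘(ℝ, ℝ) ψ x = 0) ∧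
        sliceEnergy (Kerr.exterior M a) ψ 0 ≤ ENNReal.ofReal C ∧
        ENNReal.ofReal c ≤ localSliceEnergy (Kerr.exterior M a) ψ T R := by
  obtain ⟨R₀, hR⟩ := h M a hM ha₀ haM
  refine ⟨R₀, fun R hRR ↦ ?_⟩
  obtain ⟨c, C, hc, hsol⟩ := hR R hRR
  refine ⟨c, C, hc, fun T hT ↦ ?_⟩
  obtain ⟨ψ, hψ, hwave, hsupp, hE₀, hloc⟩ := hsol T hT
  exact ⟨ψ, hψ, hwave, hsupp, hE₀, hloc T hT le_rfl⟩

/-- **The integrated (ILED / Morawetz) form is excluded by the same input** (Sbierski's ILED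
criterion, Anal. PDE 8 (2015), Thm. 5.7 — arXiv Thm. 10: if
`∫₀^{τ*} −g(N, γ̇)|_{Im γ ∩ Σ_τ} dτ = ∞` "then there exists no constant `C > 0` such that
`∫₀^{τ*} ∫_{Σ_τ ∩ 𝒯} J^N(u) · n_{Σ_τ} vol dτ ≤ C E^N_0(u)` holds for all solutions `u` of the wave
equation", "the proof of this theorem goes along the same lines as the one of Theorem [5.5]" —
applied, as Thm. 7.4 applies Thm. 5.5, along the trapped `γ_{r₀}` of §7A, whose `N`-energy is
bounded below so that the integral diverges). In the vendored rendering: for `0 < M`,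
`0 ≤ a ≤ M` there is `R₀` such that for every `R ≥ R₀` and every real `C'` it is **not** the case
that every `C^∞` `ψ : Kerr.exterior M a → ℝ` solving `□_{g_{M,a}} ψ = 0` on `{t* > 0}` with
Cauchy data supported in `{‖y‖ ≤ R}` satisfies
`∫₀^∞ localSliceEnergy ψ τ R dτ ≤ C' · sliceEnergy ψ 0` — the non-degenerate integrated local
energy decay estimate in terms of the first-order initial energy fails in the same data-localised
class as `SbierskiTrappingObstruction` (whose `scope_caveats` (i) records the ILED criterion as not
vendored: it is a corollary of the vendored localised solutions, the constants `c`, `C` of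
`SbierskiKerrLocalisedSolutions` being uniform in `T`). Proof as printed: with `c`, `C` from the
fact take `T = (|C'| |C| + c) / c`; the localised solution for this `T` has
`∫₀^∞ localSliceEnergy ψ τ R dτ ≥ c T = |C'| |C| + c > |C'| |C| ≥ C' · sliceEnergy ψ 0`.
[cite: Sbierski2015, Thm. 5.7 and §7A] -/
theorem SbierskiKerrLocalisedSolutions.not_integratedDecay (h : SbierskiKerrLocalisedSolutions)
    [Kerr.Facts] [Kerr.SliceFacts] {M a : ℝ} (hM : 0 < M) (ha₀ : 0 ≤ a) (haM : a ≤ M) :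
    ∃ R₀ : ℝ, ∀ R : ℝ, R₀ ≤ R → ∀ C' : ℝ,
      ¬ ∀ ψ : Kerr.exterior M a → ℝ,
          ContMDiff 𝓘(ℝ, E4) 𝓘(ℝ, ℝ) ∞ ψ →
          (∀ x : Kerr.exterior M a, 0 < (x : E4) 0 →
            (Kerr.smoothMetric M a (Kerr.rPlus M a)).toPseudoRiemannianMetric.dalembertian ψ x
              = 0) →
          (∀ x : Kerr.exterior M a, (x : E4) 0 = 0 → R < E4.spatialNorm (x : E4) →
            ψ x = 0 ∧ mfderiv 𝓘(ℝ, E4) 𝓘(ℝ, ℝ) ψ x = 0) →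
          ∫⁻ τ in Ici (0 : ℝ), localSliceEnergy (Kerr.exterior M a) ψ τ R ≤
            ENNReal.ofReal C' * sliceEnergy (Kerr.exterior M a) ψ 0 := by
  obtain ⟨R₀, hR⟩ := h M a hM ha₀ haM
  refine ⟨R₀, fun R hRR C' hall ↦ ?_⟩
  obtain ⟨c, C, hc, hsol⟩ := hR R hRR
  -- a time `T ≥ 0` with `c · T > |C'| · |C|`
  set T : ℝ := (|C'| * |C| + c) / c with hT
  have hT₀ : 0 ≤ T := by positivity
  have hcT : c * T = |C'| * |C| + c := by rw [hT]; field_simp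
  obtain ⟨ψ, hψ, hwave, hsupp, hE₀, hloc⟩ := hsol T hT₀
  -- lower bound: the local energy in the ball is `≥ c` throughout `[0, T]`
  have hlow : ENNReal.ofReal (c * T) ≤
      ∫⁻ τ in Ici (0 : ℝ), localSliceEnergy (Kerr.exterior M a) ψ τ R :=
    calc ENNReal.ofReal (c * T) = ∫⁻ _ in Icc (0 : ℝ) T, ENNReal.ofReal c := by
          rw [MeasureTheory.setLIntegral_const, Real.volume_Icc, sub_zero,
            ENNReal.ofReal_mul hc.le]
      _ ≤ ∫⁻ τ in Icc (0 : ℝ) T, localSliceEnergy (Kerr.exterior M a) ψ τ R :=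
          MeasureTheory.setLIntegral_mono' measurableSet_Icc fun τ hτ ↦ hloc τ hτ.1 hτ.2
      _ ≤ ∫⁻ τ in Ici (0 : ℝ), localSliceEnergy (Kerr.exterior M a) ψ τ R :=
          MeasureTheory.lintegral_mono_set Icc_subset_Ici_self
  -- upper bound: the putative integrated estimate for this localised solution
  have hup : ∫⁻ τ in Ici (0 : ℝ), localSliceEnergy (Kerr.exterior M a) ψ τ R ≤
      ENNReal.ofReal (|C'| * |C|) :=
    calc ∫⁻ τ in Ici (0 : ℝ), localSliceEnergy (Kerr.exterior M a) ψ τ R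
        ≤ ENNReal.ofReal C' * sliceEnergy (Kerr.exterior M a) ψ 0 := hall ψ hψ hwave hsupp
      _ ≤ ENNReal.ofReal |C'| * ENNReal.ofReal |C| :=
          mul_le_mul' (ENNReal.ofReal_le_ofReal (le_abs_self C'))
            (hE₀.trans (ENNReal.ofReal_le_ofReal (le_abs_self C)))
      _ = ENNReal.ofReal (|C'| * |C|) := (ENNReal.ofReal_mul (abs_nonneg C')).symm
  have hlt : ENNReal.ofReal (|C'| * |C|) < ENNReal.ofReal (c * T) :=
    (ENNReal.ofReal_lt_ofReal_iff (by positivity)).2 (by rw [hcT]; linarith)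
  exact absurd (hlow.trans hup) (not_le.2 hlt)

end Literature.Barriers.FinalStateConjecture

end
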